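import Literature.NumberTheory.Rogawski1990.UnipotentLevelPiecesFrameCM          -- ★ frame: `localNonsplitEquiv`, `conj_localNonsplitEquiv_sub_one_pow_eq_zero`, `mem_cmLocalIntegralLevel_iff_mapGL_stdLattice_eq`, `isIntMatrix_inv_of_mem_unitaryGroupOfForm`, `cmLocalIntegralLevel`
import Literature.NumberTheory.Automorphic.UnitaryThreeUnipotentCentralizers       -- ★ `mul_cornerUnipotent_eq_cornerUnipotent_mul_iff`, `diagonal_mem_unitaryGroupOfForm_three_iff`
import Literature.NumberTheory.Automorphic.UnitaryThreeUnipotentConjugacy          -- ★ `exists_conj_coe_eq_upperUnipotent`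
import Literature.NumberTheory.Automorphic.UnitaryLatticeTreeTypeTwoHyperbolic      -- ★ `eq_one_of_mul_self_eq_one` (`a·a = 1 ⇒ a = 1` in `ℤᵐ⁰`)
import HarnessLib

/-!
# The centraliser of a non-trivial unipotent element of `U(3)` over a non-archimedean local field is a union of compact subgroups
(Rogawski 1990, §3.9 p. 32: `G_u = S·N` for `u = n(t)`; for regular `u`, `G_u = Z·C_N(u)`)

Topic `NumberTheory/Rogawski1990`; namespaces `Literature.NumberTheory.Rogawski1990` (generic §1, CM head §3), `Literature.NumberTheory.Automorphic.UnitaryGroup`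
(matrix side §2).  THEOREMS ONLY (no definition, no instance, no notation, no named fact, no `sorry`).  Cell `pub/hodgecm-mathlib`, crux H413 =
`stmt-HodgeConjecture-24833`, line LH4 (closer stub `stub_N6ns`), Shalika sub-road organ «CENT-BDD»: the algebraic half of the Ranga-Rao EXISTENCE for the orbital
measures at the unipotent classes of `G = U(Φ₃)(L⁺_v)` — every element of the centraliser `G_γ` of a unipotent `γ ≠ 1` lies in a COMPACT SUBGROUP of `G_γ`
(so `G_γ` is unimodular, «UNIMOD-∪K», and `G ⧸ G_γ` carries an invariant measure, ★ `InvariantQuotientExistence`).  No oddness ∕ unramifiedness needed.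

MATHEMATICS.  Conjugate `γ` into `N` (★ `exists_conj_coe_eq_upperUnipotent`, any field).  A `g ∈ U(σ, J₀)` commuting with `u(a, b) ≠ 1` is UPPER TRIANGULAR with
`g₀₀ = g₂₂` (singular `a = 0`: ★ `mul_cornerUnipotent_eq_cornerUnipotent_mul_iff`; regular: `upperTriangular_of_commute_upperUnipotentABC`); unitarity forces
`σ(g₀₀)·g₂₂ = σ(g₁₁)·g₁₁ = 1` (`diag_rel_of_upperTriangular_mem`), so `|g_ii| = 1` (`v_diag_eq_one_of_upperTriangular_mem`); the unitary torus element
`diag(ϖⁿ, 1, σ(ϖⁿ)⁻¹)` scales the upper entries into `𝒪` (`exists_mem_isIntMatrix_conj_of_upperTriangular`, `exists_mem_isIntMatrix_conj_of_commute_unipotent`); back on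
`G` the conjugate lies in the hyperspecial compact open `K_std` (★ `mem_cmLocalIntegralLevel_iff_mapGL_stdLattice_eq`, ★ `isCompact_isOpen_cmLocalIntegralLevel`), and a
conjugate of `K_std` meets the closed centraliser in a compact subgroup (`exists_isCompact_subgroup_centralizer_of_conj_mem`).  HEADS (§3):
**`exists_isCompact_subgroup_of_mem_centralizer_unipotent`** (`Φ₃`; binders `(L) (v) (w) (hsub) {γ} (hγ) (hγ1) (g)`, no oddness hypothesis) and `…_of_placeForm_eq` (any `H′`
with `H′_w = J₀`).
HONEST LABEL: elementary structure of `U(3)`, count-neutral, pays no letter by itself; HC_CM is proved only modulo the 7 printed citations (2 remaining: hLiu418 =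
stmt-HodgeConjecture-24832, h413 = stmt-HodgeConjecture-24833) until rung 0 closes.

## References
* [Rogawski1990] J. D. Rogawski, *Automorphic Representations of Unitary Groups in Three Variables*, Ann. of Math. Stud. 123 (1990): §3.9 p. 32 (`G_u = S·N`),
  §1.10 p. 9 (`M`, `N`), §4.9 p. 54 (`K` hyperspecial), §8.1 p. 112 (measures on the unipotent classes).
* [Tits1979] J. Tits, *Reductive groups over local fields*, PSPM 33.1 (1979), §3.8 (hyperspecial `U(J)(𝒪)`).
* [PlatonovRapinchuk1994] V. Platonov, A. Rapinchuk, *Algebraic Groups and Number Theory* (1994), §3.3 (compact subgroups of `p`-adic groups).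
-/

set_option autoImplicit false

noncomputable section

open scoped Valued WithZero Matrix MatrixGroups
open Topology Set NumberField IsDedekindDomain Matrix

/-! ## §1 Generic: a conjugate of a compact subgroup meets a centraliser in a compact subgroup -/

namespace Literature.NumberTheory.Rogawski1990

section Generic

variable {G : Type*} [Group G] [TopologicalSpace G]

/-- The centraliser of one element is closed in a Hausdorff topological group (`{g ∣ g γ = γ g}` is an equaliser) — local copy of ★
`Literature.NumberTheory.Automorphic.isClosed_centralizer_singleton` (★ `QuaternionUnitsTraceClasses`, not imported here). [cite: PlatonovRapinchuk1994, §3.3] -/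
private theorem isClosed_centralizer_singleton_centBdd [T2Space G] [ContinuousMul G] (γ : G) :
    IsClosed ((Subgroup.centralizer ({γ} : Set G) : Subgroup G) : Set G) := by
  have h : ((Subgroup.centralizer ({γ} : Set G) : Subgroup G) : Set G) = {g : G | g * γ = γ * g} :=
    Set.ext fun _ => Subgroup.mem_centralizer_singleton_iff
  rw [h]
  exact isClosed_eq (continuous_id.mul continuous_const) (continuous_const.mul continuous_id)

/-- **A conjugate of a compact subgroup meets a centraliser in a compact subgroup.**  If `C ≤ G` is a compact subgroup of a Hausdorff topological group,
`c` centralises `γ` and `y c y⁻¹ ∈ C`, then `c` lies in the compact subgroup `y⁻¹ C y ∩ G_γ` of the centraliser `G_γ` (the centraliser is closed, so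
its inclusion is a closed embedding). [cite: PlatonovRapinchuk1994, §3.3] -/
theorem exists_isCompact_subgroup_centralizer_of_conj_mem [IsTopologicalGroup G] [T2Space G]
    (C : Subgroup G) (hC : IsCompact (C : Set G)) {γ : G} (c : ↥(Subgroup.centralizer ({γ} : Set G))) {y : G}
    (hy : y * (c : G) * y⁻¹ ∈ C) :
    ∃ K : Subgroup ↥(Subgroup.centralizer ({γ} : Set G)),
      IsCompact (K : Set ↥(Subgroup.centralizer ({γ} : Set G))) ∧ c ∈ K := by
  set C' : Subgroup G := C.comap (MulAut.conj y).toMonoidHom with hC'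
  have hmem : (c : G) ∈ C' := by rw [hC', Subgroup.mem_comap]; exact hy
  have hC'c : IsCompact (C' : Set G) := by
    have hset : (C' : Set G) = ((Homeomorph.mulLeft y).trans (Homeomorph.mulRight y⁻¹)) ⁻¹' (C : Set G) :=
      Set.ext fun g => by rw [hC', Subgroup.coe_comap, Set.mem_preimage, Set.mem_preimage]; rfl
    rw [hset]; exact (Homeomorph.isCompact_preimage _).2 hC
  refine ⟨C'.subgroupOf (Subgroup.centralizer ({γ} : Set G)), ?_, Subgroup.mem_subgroupOf.2 hmem⟩
  show IsCompact (((↑) : ↥(Subgroup.centralizer ({γ} : Set G)) → G) ⁻¹' (C' : Set G))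
  exact (isClosed_centralizer_singleton_centBdd γ).isClosedEmbedding_subtypeVal.isCompact_preimage hC'c

end Generic

end Literature.NumberTheory.Rogawski1990

/-! ## §2 Matrix side: the centraliser of a unipotent `u ≠ 1` in `U(σ, J₀)` conjugates into `M₃(𝒪)` -/

namespace Literature.NumberTheory.Automorphic.UnitaryGroup

open Literature.NumberTheory.Automorphic.HermitianLattice Literature.NumberTheory.Automorphic.UnitaryLatticeTree
open Literature.NumberTheory.Rogawski1990

section Algebra

variable {K : Type*} [Field K] (σ : K →+* K)

/-- Entries of `g·u(a,b,c)` with `u(a,b,c) = (1, a, b; 0, 1, c; 0, 0, 1)`. [cite: Rogawski1990, §1.10 p. 9] -/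
theorem mul_upperUnipotentABC_apply (g : Matrix (Fin 3) (Fin 3) K) (a b c : K) (i : Fin 3) :
    (g * !![1, a, b; 0, 1, c; 0, 0, 1]) i 0 = g i 0 ∧ (g * !![1, a, b; 0, 1, c; 0, 0, 1]) i 1 = g i 0 * a + g i 1 ∧
      (g * !![1, a, b; 0, 1, c; 0, 0, 1]) i 2 = g i 0 * b + g i 1 * c + g i 2 := by
  refine ⟨?_, ?_, ?_⟩ <;> simp [Matrix.mul_apply, Fin.sum_univ_three]

/-- Entries of `u(a,b,c)·g`. [cite: Rogawski1990, §1.10 p. 9] -/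
theorem upperUnipotentABC_mul_apply (g : Matrix (Fin 3) (Fin 3) K) (a b c : K) (j : Fin 3) :
    (!![1, a, b; 0, 1, c; 0, 0, 1] * g) 0 j = g 0 j + a * g 1 j + b * g 2 j ∧ (!![1, a, b; 0, 1, c; 0, 0, 1] * g) 1 j = g 1 j + c * g 2 j ∧
      (!![1, a, b; 0, 1, c; 0, 0, 1] * g) 2 j = g 2 j := by
  refine ⟨?_, ?_, ?_⟩ <;> simp [Matrix.mul_apply, Fin.sum_univ_three]

/-- **The centraliser of a REGULAR unipotent `u(a, b, c)` (`a ≠ 0`, `c ≠ 0`) in `M₃(K)`**: a commuting `g` is upper triangular with ALL THREE diagonal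
entries equal (the twin of ★ `mul_cornerUnipotent_eq_cornerUnipotent_mul_iff` for the singular `n(t)`; `G_u = Z·C_N(u)` inside `U(3)`).
[cite: Rogawski1990, §3.9 p. 32] -/
theorem upperTriangular_of_commute_upperUnipotentABC {a b c : K} (ha : a ≠ 0) (hc : c ≠ 0) (g : Matrix (Fin 3) (Fin 3) K)
    (h : g * !![1, a, b; 0, 1, c; 0, 0, 1] = !![1, a, b; 0, 1, c; 0, 0, 1] * g) :
    g 1 0 = 0 ∧ g 2 0 = 0 ∧ g 2 1 = 0 ∧ g 0 0 = g 1 1 ∧ g 1 1 = g 2 2 := by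
  have e := fun i j => congr_fun (congr_fun h i) j
  have h21 := e 2 1; have h22 := e 2 2; have h11 := e 1 1; have h12 := e 1 2; have h01 := e 0 1
  rw [(mul_upperUnipotentABC_apply g a b c 2).2.1, (upperUnipotentABC_mul_apply g a b c 1).2.2] at h21
  rw [(mul_upperUnipotentABC_apply g a b c 2).2.2, (upperUnipotentABC_mul_apply g a b c 2).2.2] at h22
  rw [(mul_upperUnipotentABC_apply g a b c 1).2.1, (upperUnipotentABC_mul_apply g a b c 1).2.1] at h11
  rw [(mul_upperUnipotentABC_apply g a b c 1).2.2, (upperUnipotentABC_mul_apply g a b c 2).2.1] at h12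
  rw [(mul_upperUnipotentABC_apply g a b c 0).2.1, (upperUnipotentABC_mul_apply g a b c 1).1] at h01
  -- `h21 : g₂₀ a + g₂₁ = g₂₁`, `h22 : g₂₀ b + g₂₁ c + g₂₂ = g₂₂`, `h11 : g₁₀ a + g₁₁ = g₁₁ + c g₂₁`, `h12 : g₁₀ b + g₁₁ c + g₁₂ = g₁₂ + c g₂₂`, `h01 : …`
  have h20 : g 2 0 = 0 := (mul_eq_zero.1 (by linear_combination h21 : g 2 0 * a = 0)).resolve_right ha
  have h21' : g 2 1 = 0 := (mul_eq_zero.1 (by linear_combination h22 - b * h20 : g 2 1 * c = 0)).resolve_right hc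
  have h10 : g 1 0 = 0 := (mul_eq_zero.1 (by linear_combination h11 + c * h21' : g 1 0 * a = 0)).resolve_right ha
  have h1122 : g 1 1 = g 2 2 :=
    sub_eq_zero.1 ((mul_eq_zero.1 (by linear_combination h12 - b * h10 : (g 1 1 - g 2 2) * c = 0)).resolve_right hc)
  have h0011 : g 0 0 = g 1 1 :=
    sub_eq_zero.1 ((mul_eq_zero.1 (by linear_combination h01 + b * h21' : (g 0 0 - g 1 1) * a = 0)).resolve_right ha)
  exact ⟨h10, h20, h21', h0011, h1122⟩

/-- **Unitarity of an upper triangular element of `U(σ, J₀)`**: `σ(g₀₀)·g₂₂ = 1` and `σ(g₁₁)·g₁₁ = 1` (`B₀(g e₀, g e₂) = B₀(e₀, e₂) = 1`,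
`B₀(g e₁, g e₁) = 1` for the antidiagonal form). [cite: Rogawski1990, §1.10 p. 9] -/
theorem diag_rel_of_upperTriangular_mem {g : GL (Fin 3) K} (hg : g ∈ unitaryGroupOfForm σ ((StdForm.antidiagonal 3).over K))
    (h10 : (g : Matrix (Fin 3) (Fin 3) K) 1 0 = 0) (h20 : (g : Matrix (Fin 3) (Fin 3) K) 2 0 = 0)
    (h21 : (g : Matrix (Fin 3) (Fin 3) K) 2 1 = 0) :
    σ ((g : Matrix (Fin 3) (Fin 3) K) 0 0) * (g : Matrix (Fin 3) (Fin 3) K) 2 2 = 1 ∧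
      σ ((g : Matrix (Fin 3) (Fin 3) K) 1 1) * (g : Matrix (Fin 3) (Fin 3) K) 1 1 = 1 := by
  set G : Matrix (Fin 3) (Fin 3) K := (g : Matrix (Fin 3) (Fin 3) K) with hG
  have hinv := (mem_unitaryGroupOfForm_antidiagonal_iff (σ := σ) (N := 3) g).1 hg
  have hGe : ∀ i j, (G *ᵥ Pi.single j 1) i = G i j := fun i j => by rw [Matrix.mulVec_single_one]; rfl
  refine ⟨?_, ?_⟩
  · have h := hinv (Pi.single 0 1) (Pi.single 2 1)
    rw [B₀_three_apply, B₀_three_apply, hGe, hGe, hGe, hGe, hGe, hGe, h10, h20] at h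
    simpa using h
  · have h := hinv (Pi.single 1 1) (Pi.single 1 1)
    rw [B₀_three_apply, B₀_three_apply, hGe, hGe, hGe, h21] at h
    simpa using h

/-- The unitary torus element `diag(x, 1, (σx)⁻¹)` as a unit, with inverse `diag(x⁻¹, 1, σx)`. [cite: Rogawski1990, §1.10 p. 9] -/
theorem exists_units_coe_eq_scalingTorus {x : K} (hx : x ≠ 0) (hσx : σ x ≠ 0) :
    ∃ m : GL (Fin 3) K, (m : Matrix (Fin 3) (Fin 3) K) = Matrix.diagonal ![x, 1, (σ x)⁻¹] ∧
      ((m⁻¹ : GL (Fin 3) K) : Matrix (Fin 3) (Fin 3) K) = Matrix.diagonal ![x⁻¹, 1, σ x] := by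
  have h1 : Matrix.diagonal ![x, 1, (σ x)⁻¹] * Matrix.diagonal ![x⁻¹, 1, σ x] = 1 := by
    rw [Matrix.diagonal_mul_diagonal, ← Matrix.diagonal_one]
    congr 1; funext i; fin_cases i <;> simp [mul_inv_cancel₀ hx, inv_mul_cancel₀ hσx]
  have h2 : Matrix.diagonal ![x⁻¹, 1, σ x] * Matrix.diagonal ![x, 1, (σ x)⁻¹] = 1 := by
    rw [Matrix.diagonal_mul_diagonal, ← Matrix.diagonal_one]
    congr 1; funext i; fin_cases i <;> simp [mul_inv_cancel₀ hσx, inv_mul_cancel₀ hx]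
  exact ⟨⟨_, _, h1, h2⟩, rfl, rfl⟩

end Algebra

section Valued

variable {K : Type*} [Field K] [Valued K ℤᵐ⁰] (σ : K →+* K)

/-- **`|g₀₀| = |g₁₁| = |g₂₂| = 1`** for an upper triangular `g ∈ U(σ, J₀)` with `g₀₀ = g₂₂` (`σ` preserves `|·|`; `σ(g₀₀)·g₂₂ = 1`, `σ(g₁₁)·g₁₁ = 1`).
[cite: Rogawski1990, §3.9 p. 32] -/
theorem v_diag_eq_one_of_upperTriangular_mem (hvσ : ∀ a, Valued.v (σ a) = Valued.v a) {g : GL (Fin 3) K}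
    (hg : g ∈ unitaryGroupOfForm σ ((StdForm.antidiagonal 3).over K))
    (h10 : (g : Matrix (Fin 3) (Fin 3) K) 1 0 = 0) (h20 : (g : Matrix (Fin 3) (Fin 3) K) 2 0 = 0)
    (h21 : (g : Matrix (Fin 3) (Fin 3) K) 2 1 = 0) (h0022 : (g : Matrix (Fin 3) (Fin 3) K) 0 0 = (g : Matrix (Fin 3) (Fin 3) K) 2 2) :
    Valued.v ((g : Matrix (Fin 3) (Fin 3) K) 0 0) = 1 ∧ Valued.v ((g : Matrix (Fin 3) (Fin 3) K) 1 1) = 1 ∧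
      Valued.v ((g : Matrix (Fin 3) (Fin 3) K) 2 2) = 1 := by
  obtain ⟨h02, h11⟩ := diag_rel_of_upperTriangular_mem σ hg h10 h20 h21
  have hv11 : Valued.v ((g : Matrix (Fin 3) (Fin 3) K) 1 1) = 1 := by
    have h := congrArg Valued.v h11
    rw [map_mul, hvσ, map_one] at h; exact eq_one_of_mul_self_eq_one h
  have hv22 : Valued.v ((g : Matrix (Fin 3) (Fin 3) K) 2 2) = 1 := by
    have h := congrArg Valued.v h02
    rw [map_mul, hvσ, map_one, h0022] at h; exact eq_one_of_mul_self_eq_one h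
  exact ⟨by rw [h0022]; exact hv22, hv11, hv22⟩

/-- In `ℤᵐ⁰`, powers of `|ϖ| = exp(−1)` bring any value below `1`. [cite: Tits1979, §3.8] -/
theorem exists_pow_mul_le_one_withZero {ϖ : K} (hϖ : Valued.v ϖ = WithZero.exp (-1 : ℤ)) (y : ℤᵐ⁰) :
    ∃ n : ℕ, Valued.v ϖ ^ n * y ≤ 1 := by
  by_cases hy : y = 0
  · exact ⟨0, by rw [hy, mul_zero]; exact zero_le⟩
  · obtain ⟨k, rfl⟩ : ∃ k : ℤ, y = WithZero.exp k := ⟨WithZero.log y, (WithZero.exp_log hy).symm⟩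
    refine ⟨k.toNat, ?_⟩
    rw [hϖ, ← WithZero.exp_nsmul, ← WithZero.exp_add, ← WithZero.exp_zero, WithZero.exp_le_exp]
    have hk : k ≤ (k.toNat : ℤ) := Int.self_le_toNat k
    simp only [smul_neg, nsmul_eq_mul, mul_one]
    linarith

/-- **Scaling into `M₃(𝒪)` by the unitary torus.**  An upper triangular `g ∈ GL₃(K)` with integral diagonal is conjugated by a suitable
`m = diag(ϖⁿ, 1, σ(ϖⁿ)⁻¹) ∈ U(σ, J₀)` (`σ` an involution preserving `|·|`) to an INTEGRAL matrix: the entries of `m g m⁻¹` are `g₀₀, ϖⁿ g₀₁,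
ϖⁿ σ(ϖⁿ) g₀₂, g₁₁, σ(ϖⁿ) g₁₂, g₂₂` and zeros. [cite: Rogawski1990, §3.9 p. 32] [cite: Tits1979, §3.8] -/
theorem exists_mem_isIntMatrix_conj_of_upperTriangular (hσ : ∀ z, σ (σ z) = z) (hvσ : ∀ a, Valued.v (σ a) = Valued.v a)
    {ϖ : K} (hϖ : Valued.v ϖ = WithZero.exp (-1 : ℤ)) {g : GL (Fin 3) K}
    (h10 : (g : Matrix (Fin 3) (Fin 3) K) 1 0 = 0) (h20 : (g : Matrix (Fin 3) (Fin 3) K) 2 0 = 0)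
    (h21 : (g : Matrix (Fin 3) (Fin 3) K) 2 1 = 0) (hd0 : Valued.v ((g : Matrix (Fin 3) (Fin 3) K) 0 0) ≤ 1)
    (hd1 : Valued.v ((g : Matrix (Fin 3) (Fin 3) K) 1 1) ≤ 1) (hd2 : Valued.v ((g : Matrix (Fin 3) (Fin 3) K) 2 2) ≤ 1) :
    ∃ m : GL (Fin 3) K, m ∈ unitaryGroupOfForm σ ((StdForm.antidiagonal 3).over K) ∧
      IsIntMatrix (((m * g * m⁻¹ : GL (Fin 3) K) : Matrix (Fin 3) (Fin 3) K)) := by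
  set G : Matrix (Fin 3) (Fin 3) K := (g : Matrix (Fin 3) (Fin 3) K) with hG
  have hϖ0 : ϖ ≠ 0 := fun h0 => by rw [h0, map_zero] at hϖ; exact WithZero.exp_ne_zero hϖ.symm
  have hϖ1 : Valued.v ϖ ≤ 1 := by rw [hϖ, ← WithZero.exp_zero, WithZero.exp_le_exp]; norm_num
  obtain ⟨n₁, h₁⟩ := exists_pow_mul_le_one_withZero hϖ (Valued.v (G 0 1))
  obtain ⟨n₂, h₂⟩ := exists_pow_mul_le_one_withZero hϖ (Valued.v (G 1 2))
  obtain ⟨n₃, h₃⟩ := exists_pow_mul_le_one_withZero hϖ (Valued.v (G 0 2))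
  set n : ℕ := n₁ + n₂ + n₃ with hn
  have hanti : ∀ {k : ℕ}, k ≤ n → ∀ {y : ℤᵐ⁰}, Valued.v ϖ ^ k * y ≤ 1 → Valued.v ϖ ^ n * y ≤ 1 :=
    fun {k} hk {y} hy => (mul_le_mul' (pow_le_pow_right_of_le_one' hϖ1 hk) le_rfl).trans hy
  have h01 : Valued.v ϖ ^ n * Valued.v (G 0 1) ≤ 1 := hanti (by omega) h₁
  have h12 : Valued.v ϖ ^ n * Valued.v (G 1 2) ≤ 1 := hanti (by omega) h₂
  have h02 : Valued.v ϖ ^ n * Valued.v (G 0 2) ≤ 1 := hanti (by omega) h₃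
  have hϖn1 : Valued.v ϖ ^ n ≤ 1 := pow_le_one' hϖ1 n
  have hϖn0 : Valued.v ϖ ^ n ≠ 0 := pow_ne_zero _ (by rw [hϖ]; exact WithZero.exp_ne_zero)
  set x : K := ϖ ^ n with hx
  have hx0 : x ≠ 0 := pow_ne_zero _ hϖ0
  have hσx0 : σ x ≠ 0 := (map_ne_zero σ).2 hx0
  have hvx : Valued.v x = Valued.v ϖ ^ n := map_pow _ _ _
  obtain ⟨m, hm, hm'⟩ := exists_units_coe_eq_scalingTorus σ hx0 hσx0
  refine ⟨m, (diagonal_mem_unitaryGroupOfForm_three_iff σ hm).2 ⟨?_, ?_, ?_⟩, ?_⟩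
  · exact mul_inv_cancel₀ hσx0
  · rw [map_one, one_mul]
  · rw [map_inv₀, hσ, inv_mul_cancel₀ hx0]
  · have hconj_apply : ∀ i j, ((m * g * m⁻¹ : GL (Fin 3) K) : Matrix (Fin 3) (Fin 3) K) i j =
        (![x, 1, (σ x)⁻¹] : Fin 3 → K) i * G i j * (![x⁻¹, 1, σ x] : Fin 3 → K) j := by
      intro i j
      rw [Units.val_mul, Units.val_mul, hm, hm', Matrix.mul_diagonal, Matrix.diagonal_mul]
    have hD0 : (![x, 1, (σ x)⁻¹] : Fin 3 → K) 0 = x := rfl; have hD1 : (![x, 1, (σ x)⁻¹] : Fin 3 → K) 1 = 1 := rfl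
    have hD2 : (![x, 1, (σ x)⁻¹] : Fin 3 → K) 2 = (σ x)⁻¹ := rfl; have hE0 : (![x⁻¹, 1, σ x] : Fin 3 → K) 0 = x⁻¹ := rfl
    have hE1 : (![x⁻¹, 1, σ x] : Fin 3 → K) 1 = 1 := rfl; have hE2 : (![x⁻¹, 1, σ x] : Fin 3 → K) 2 = σ x := rfl
    have h3 : ∀ i : Fin 3, i = 0 ∨ i = 1 ∨ i = 2 := by decide
    intro i j
    rw [hconj_apply, map_mul, map_mul]
    rcases h3 i with rfl | rfl | rfl <;> rcases h3 j with rfl | rfl | rfl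
    · rw [hD0, hE0, map_inv₀, hvx, mul_right_comm, mul_inv_cancel₀ hϖn0, one_mul]; exact hd0            -- (0,0)
    · rw [hD0, hE1, map_one, mul_one, hvx]; exact h01                                                        -- (0,1)
    · rw [hD0, hE2, hvσ, hvx]; exact mul_le_one' h02 hϖn1                                                    -- (0,2)
    · rw [h10, map_zero, mul_zero, zero_mul]; exact zero_le                                                  -- (1,0)
    · rw [hD1, hE1, map_one, one_mul, mul_one]; exact hd1                                                    -- (1,1)
    · rw [hD1, hE2, map_one, one_mul, hvσ, hvx, mul_comm (Valued.v (G 1 2))]; exact h12                     -- (1,2)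
    · rw [h20, map_zero, mul_zero, zero_mul]; exact zero_le                                                  -- (2,0)
    · rw [h21, map_zero, mul_zero, zero_mul]; exact zero_le                                                  -- (2,1)
    · rw [hD2, hE2, map_inv₀, hvσ, hvx, mul_right_comm, inv_mul_cancel₀ hϖn0, one_mul]; exact hd2            -- (2,2)

/-- **THE CENTRALISER OF A UNIPOTENT `u ≠ 1` OF `U(σ, J₀)` CONJUGATES INTO `M₃(𝒪)`, element by element.**  `σ` an involution preserving `|·|`, `|ϖ| = exp(−1)`:
for `u ∈ U(σ, J₀)` with `(u − 1)³ = 0`, `u ≠ 1`, and `g ∈ U(σ, J₀)` commuting with `u`, some `y ∈ U(σ, J₀)` has `y g y⁻¹` INTEGRAL.  Proof: ★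
`exists_conj_coe_eq_upperUnipotent` (`k u k⁻¹ = u(a, b) ∈ N`), the centraliser of `u(a, b)` is upper triangular with unit-norm diagonal (singular `a = 0`: ★
`mul_cornerUnipotent_eq_cornerUnipotent_mul_iff`; regular: `upperTriangular_of_commute_upperUnipotentABC`), then `exists_mem_isIntMatrix_conj_of_upperTriangular`.
[cite: Rogawski1990, §3.9 p. 32] [cite: Tits1979, §3.8] -/
theorem exists_mem_isIntMatrix_conj_of_commute_unipotent (hσ : ∀ z, σ (σ z) = z) (hvσ : ∀ a, Valued.v (σ a) = Valued.v a)
    {ϖ : K} (hϖ : Valued.v ϖ = WithZero.exp (-1 : ℤ)) {u g : GL (Fin 3) K}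
    (hu : u ∈ unitaryGroupOfForm σ ((StdForm.antidiagonal 3).over K)) (hg : g ∈ unitaryGroupOfForm σ ((StdForm.antidiagonal 3).over K))
    (hnil : ((u : Matrix (Fin 3) (Fin 3) K) - 1) ^ 3 = 0) (hu1 : u ≠ 1) (hcomm : g * u = u * g) :
    ∃ y : GL (Fin 3) K, y ∈ unitaryGroupOfForm σ ((StdForm.antidiagonal 3).over K) ∧
      IsIntMatrix (((y * g * y⁻¹ : GL (Fin 3) K) : Matrix (Fin 3) (Fin 3) K)) := by
  obtain ⟨k, hk, a, b, hshape, -⟩ := exists_conj_coe_eq_upperUnipotent σ hσ hu ⟨3, hnil⟩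
  set g' : GL (Fin 3) K := k * g * k⁻¹ with hg'
  have hg'U : g' ∈ unitaryGroupOfForm σ ((StdForm.antidiagonal 3).over K) := mul_mem (mul_mem hk hg) (inv_mem hk)
  have hcommU : g' * (k * u * k⁻¹) = k * u * k⁻¹ * g' := by
    calc k * g * k⁻¹ * (k * u * k⁻¹) = k * (g * u) * k⁻¹ := by group
      _ = k * (u * g) * k⁻¹ := by rw [hcomm]
      _ = k * u * k⁻¹ * (k * g * k⁻¹) := by group
  have hcomm' : (g' : Matrix (Fin 3) (Fin 3) K) * !![1, a, b; 0, 1, -σ a; 0, 0, 1] = !![1, a, b; 0, 1, -σ a; 0, 0, 1] * (g' : Matrix (Fin 3) (Fin 3) K) := by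
    rw [← hshape, ← Units.val_mul, ← Units.val_mul, hcommU]
  have htri : (g' : Matrix (Fin 3) (Fin 3) K) 1 0 = 0 ∧ (g' : Matrix (Fin 3) (Fin 3) K) 2 0 = 0 ∧ (g' : Matrix (Fin 3) (Fin 3) K) 2 1 = 0 ∧
      (g' : Matrix (Fin 3) (Fin 3) K) 0 0 = (g' : Matrix (Fin 3) (Fin 3) K) 2 2 := by
    by_cases ha : a = 0
    · have hb : b ≠ 0 := by
        intro hb
        apply hu1
        have h1 : ((k * u * k⁻¹ : GL (Fin 3) K) : Matrix (Fin 3) (Fin 3) K) = 1 := by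
          rw [hshape, ha, hb, map_zero, neg_zero, Matrix.one_fin_three]
        calc u = k⁻¹ * (k * u * k⁻¹) * k := by group
          _ = 1 := by rw [(Units.ext h1 : k * u * k⁻¹ = 1)]; group
      rw [ha, map_zero, neg_zero] at hcomm'
      exact (mul_cornerUnipotent_eq_cornerUnipotent_mul_iff hb _).1 hcomm'
    · have hc : -σ a ≠ 0 := neg_ne_zero.2 ((map_ne_zero σ).2 ha)
      obtain ⟨h10, h20, h21, h0011, h1122⟩ := upperTriangular_of_commute_upperUnipotentABC ha hc _ hcomm'
      exact ⟨h10, h20, h21, h0011.trans h1122⟩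
  obtain ⟨h10, h20, h21, h0022⟩ := htri
  obtain ⟨hv0, hv1, hv2⟩ := v_diag_eq_one_of_upperTriangular_mem σ hvσ hg'U h10 h20 h21 h0022
  obtain ⟨m, hmU, hint⟩ := exists_mem_isIntMatrix_conj_of_upperTriangular σ hσ hvσ hϖ h10 h20 h21 hv0.le hv1.le hv2.le
  refine ⟨m * k, mul_mem hmU hk, ?_⟩
  rw [show m * k * g * (m * k)⁻¹ = m * g' * m⁻¹ by rw [hg']; group]
  exact hint

end Valued

end Literature.NumberTheory.Automorphic.UnitaryGroup

/-! ## §3 The CM head: `G = U(Φ₃)(L⁺_v) = (cmDatum L 3 Φ₃).Local v` at a non-split place -/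

namespace Literature.NumberTheory.Rogawski1990

open Literature.NumberTheory.Automorphic Literature.NumberTheory.Automorphic.UnitaryGroup Literature.NumberTheory.GaloisRepresentations
open Literature.NumberTheory.Automorphic.UnitaryLatticeTree Literature.NumberTheory.Automorphic.HermitianLattice
section CM

variable (L : Type) [Field L] [NumberField L] [IsCMField L] (v : HeightOneSpectrum (𝓞 ↥(maximalRealSubfield L)))

/-- At a place with ONE place of `L` above it, `w` is fixed by complex conjugation (★ `PlacesOver.galInv`: `c⁻¹ • w ∣ v` too).
[cite: PlatonovRapinchuk1994, §3.3] -/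
theorem complexConj_smul_eq_of_subsingleton_placesOver (w : PlacesOver L v) (hsub : Subsingleton (PlacesOver L v)) :
    IsCMField.complexConj L • w.1 = w.1 := by
  have h : (IsCMField.complexConj L)⁻¹ • w.1 = w.1 :=
    congrArg Subtype.val (Subsingleton.elim (PlacesOver.galInv (IsCMField.complexConj L) w) w)
  calc IsCMField.complexConj L • w.1 = IsCMField.complexConj L • ((IsCMField.complexConj L)⁻¹ • w.1) := by rw [h]
    _ = w.1 := smul_inv_smul _ _

omit [IsCMField L] in
/-- A global `w`-adic uniformiser: `π ∈ L` with `|π|_w = exp(−1)` in `L_w` (Mathlib `valuation_exists_uniformizer`). [cite: Tits1979, §3.8] -/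
theorem exists_valued_coe_eq_exp_neg_one (w : PlacesOver L v) :
    ∃ π : L, Valued.v (π : w.1.adicCompletion L) = WithZero.exp (-1 : ℤ) := by
  obtain ⟨π, hπ⟩ := w.1.valuation_exists_uniformizer L
  exact ⟨π, by rw [HeightOneSpectrum.valuedAdicCompletion_eq_valuation', hπ]⟩

/-- **«CENT-BDD», framed form: `H′` with `H′_w = J₀` literally.**  At a non-split place, every element of the centraliser of a unipotent `γ ≠ 1` of
`G = U(H′)(L⁺_v)` lies in a compact subgroup of the centraliser.  Through the one-place model `E : G ≃ₜ* U(σ_w, J₀)(L_w)` (★ `localNonsplitEquiv`, re-typed on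
the `cmDatum` carrier by ★ `exists_continuousMulEquiv_coe_eq_localNonsplitEquiv`): `exists_mem_isIntMatrix_conj_of_commute_unipotent` gives `y ∈ U` with
`y·E(g)·y⁻¹` integral, so `y₀ g y₀⁻¹ ∈ K_std = U(H′)(𝒪_v)` (★ `mem_cmLocalIntegralLevel_iff_mapGL_stdLattice_eq`, ★ `isIntMatrix_inv_of_mem_unitaryGroupOfForm`), a
compact open subgroup (★ `isCompact_isOpen_cmLocalIntegralLevel`); conclude by `exists_isCompact_subgroup_centralizer_of_conj_mem`.  No oddness∕unramifiedness
hypothesis. [cite: Rogawski1990, §3.9 p. 32; §4.9 p. 54] [cite: Tits1979, §3.8] -/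
theorem exists_isCompact_subgroup_of_mem_centralizer_unipotent_of_placeForm_eq (H' : Matrix (Fin 3) (Fin 3) L) (w : PlacesOver L v)
    (hsub : Subsingleton (PlacesOver L v)) (hH : placeForm H' w.1 = (StdForm.antidiagonal 3).over (w.1.adicCompletion L))
    {γ : (cmDatum L 3 H').Local v} (hγ : (((γ.val : GL (Fin 3) (UnitaryGroup.LocalRing L v)).val - 1) ^ 3) = 0) (hγ1 : γ ≠ 1)
    (g : ↥(Subgroup.centralizer ({γ} : Set ((cmDatum L 3 H').Local v)))) :
    ∃ K : Subgroup ↥(Subgroup.centralizer ({γ} : Set ((cmDatum L 3 H').Local v))),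
      IsCompact (K : Set ↥(Subgroup.centralizer ({γ} : Set ((cmDatum L 3 H').Local v)))) ∧ g ∈ K := by
  have hc1 : IsCMField.complexConj L ≠ 1 := IsCMField.complexConj_ne_one L
  have hw : IsCMField.complexConj L • w.1 = w.1 := complexConj_smul_eq_of_subsingleton_placesOver L v w hsub
  have hσσ : ∀ x, galAdicCompletionMap (L := L) (IsCMField.complexConj L) hw (galAdicCompletionMap (L := L) (IsCMField.complexConj L) hw x) = x :=
    galAdicCompletionMap_galAdicCompletionMap_of_smul_eq (IsCMField.complexConj L) w hc1 hw
  have hvσ : ∀ a, Valued.v (galAdicCompletionMap (L := L) (IsCMField.complexConj L) hw a) = Valued.v a :=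
    valued_galAdicCompletionMap (L := L) (IsCMField.complexConj L) hw
  obtain ⟨π, hπ⟩ := exists_valued_coe_eq_exp_neg_one L v w
  obtain ⟨E, hE⟩ := exists_continuousMulEquiv_coe_eq_localNonsplitEquiv L H' v w hw
  have huJ : (E γ).1 ∈ unitaryGroupOfForm (galAdicCompletionMap (L := L) (IsCMField.complexConj L) hw) ((StdForm.antidiagonal 3).over (w.1.adicCompletion L)) := by
    rw [← hH]; exact (E γ).2
  have hgJ : (E (g : (cmDatum L 3 H').Local v)).1 ∈
      unitaryGroupOfForm (galAdicCompletionMap (L := L) (IsCMField.complexConj L) hw) ((StdForm.antidiagonal 3).over (w.1.adicCompletion L)) := by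
    rw [← hH]; exact (E (g : (cmDatum L 3 H').Local v)).2
  have hnil : (((E γ).1 : Matrix (Fin 3) (Fin 3) (w.1.adicCompletion L)) - 1) ^ 3 = 0 := by
    have h := conj_localNonsplitEquiv_sub_one_pow_eq_zero L H' v w hw (T := 1) hγ
    rw [← hE] at h; simpa only [one_mul, inv_one, mul_one] using h
  have hu1 : (E γ).1 ≠ 1 := fun h1 => hγ1 (E.injective ((Subtype.ext h1 : E γ = 1).trans (map_one E).symm))
  have hcommU : (E (g : (cmDatum L 3 H').Local v)).1 * (E γ).1 = (E γ).1 * (E (g : (cmDatum L 3 H').Local v)).1 := by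
    have h := congrArg E (Subgroup.mem_centralizer_singleton_iff.1 g.2 : (g : (cmDatum L 3 H').Local v) * γ = γ * (g : (cmDatum L 3 H').Local v))
    rw [map_mul, map_mul] at h; exact congrArg Subtype.val h
  obtain ⟨y, hyJ, hint⟩ := exists_mem_isIntMatrix_conj_of_commute_unipotent (galAdicCompletionMap (L := L) (IsCMField.complexConj L) hw)
    hσσ hvσ hπ huJ hgJ hnil hu1 hcommU
  have hyH : y ∈ unitaryGroupOfForm (galAdicCompletionMap (L := L) (IsCMField.complexConj L) hw) (placeForm H' w.1) := by rw [hH]; exact hyJ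
  set y₀ : (cmDatum L 3 H').Local v := E.symm ⟨y, hyH⟩ with hy₀
  have hEy₀ : (E y₀).1 = y := by rw [hy₀, ContinuousMulEquiv.apply_symm_apply]
  have hmem : y₀ * (g : (cmDatum L 3 H').Local v) * y₀⁻¹ ∈ cmLocalIntegralLevel L 3 H' v := by
    rw [mem_cmLocalIntegralLevel_iff_mapGL_stdLattice_eq L H' v w hw, mapGL_stdLattice_eq_iff, ← hE]
    have hcoe : (E (y₀ * (g : (cmDatum L 3 H').Local v) * y₀⁻¹)).1 = y * (E (g : (cmDatum L 3 H').Local v)).1 * y⁻¹ := by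
      rw [map_mul, map_mul, map_inv, Subgroup.coe_mul, Subgroup.coe_mul, Subgroup.coe_inv, hEy₀]
    rw [hcoe]
    exact ⟨hint, isIntMatrix_inv_of_mem_unitaryGroupOfForm (galAdicCompletionMap (L := L) (IsCMField.complexConj L) hw) hvσ
      (mul_mem (mul_mem hyJ hgJ) (inv_mem hyJ)) hint⟩
  exact exists_isCompact_subgroup_centralizer_of_conj_mem (cmLocalIntegralLevel L 3 H' v) (isCompact_isOpen_cmLocalIntegralLevel L 3 H' v).1 g hmem

/-- **«CENT-BDD»: at a non-split place, EVERY ELEMENT OF THE CENTRALISER OF A UNIPOTENT `γ ≠ 1` OF `G = U(Φ₃)(L⁺_v)` LIES IN A COMPACT SUBGROUP OF THE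
CENTRALISER** — the hypothesis of «UNIMOD-∪K» (`isInvInvariant_of_forall_mem_isCompact_subgroup`) making `G_γ` unimodular, hence the existence half of the
orbital measures at the unipotent classes (★ `InvariantQuotientExistence`).  (`Φ₃_w = J₀`: ★ `placeForm_antidiagOne`.)  No oddness∕unramifiedness hypothesis.
[cite: Rogawski1990, §3.9 p. 32; §8.1 p. 112] [cite: Tits1979, §3.8] -/
theorem exists_isCompact_subgroup_of_mem_centralizer_unipotent (w : PlacesOver L v) (hsub : Subsingleton (PlacesOver L v))
    {γ : (cmDatum L 3 (Matrix.of fun i j : Fin 3 => if i.val + j.val + 1 = 3 then (1 : L) else 0)).Local v}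
    (hγ : (((γ.val : GL (Fin 3) (UnitaryGroup.LocalRing L v)).val - 1) ^ 3) = 0) (hγ1 : γ ≠ 1)
    (g : ↥(Subgroup.centralizer ({γ} : Set ((cmDatum L 3 (Matrix.of fun i j : Fin 3 => if i.val + j.val + 1 = 3 then (1 : L) else 0)).Local v)))) :
    ∃ K : Subgroup ↥(Subgroup.centralizer ({γ} : Set ((cmDatum L 3 (Matrix.of fun i j : Fin 3 => if i.val + j.val + 1 = 3 then (1 : L) else 0)).Local v))),
      IsCompact (K : Set ↥(Subgroup.centralizer
        ({γ} : Set ((cmDatum L 3 (Matrix.of fun i j : Fin 3 => if i.val + j.val + 1 = 3 then (1 : L) else 0)).Local v)))) ∧ g ∈ K :=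
  exists_isCompact_subgroup_of_mem_centralizer_unipotent_of_placeForm_eq L v _ w hsub (placeForm_antidiagOne 3 w.1) hγ hγ1 g

end CM
end Literature.NumberTheory.Rogawski1990
end
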